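import Mathlib.LinearAlgebra.Matrix.Charpoly.Coeff
import Mathlib.LinearAlgebra.Matrix.ToLinearEquiv
import Mathlib.LinearAlgebra.FiniteDimensional.Lemmas
import Mathlib.Algebra.Polynomial.Roots
import Literature.Analysis.Fourier.HyperbolicSystemsLp
import HarnessLib

/-!
# Strictly hyperbolic matrix pencils: simple real spectrum, and no linear eigenvalues when
`d ≥ 2`, `k ≥ 2`

A real `k × k` pencil `K(ξ) = Σⱼ ξⱼ Kⱼ`, `ξ ∈ ℝᵈ`, is *strictly hyperbolic* if for every
`ξ ≠ 0` the matrix `K(ξ)` has `k` pairwise distinct real eigenvalues, each with a real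
eigenvector (Rauch's standing hypothesis "strictly hyperbolic", [Rauch1986, p. 482], for the
pencil `A₀⁻¹ Σ ξⱼAⱼ`; the shape of the tree's `QuasilinearSystem.IsStrictlyHyperbolicAt`). This
file records two elementary consequences used in the strictly hyperbolic branch of Rauch's
linear step (`Rauch1986_LpMultiplier_forces_commutation`,
`Literature/Barriers/AtomisticToContinuum/NoBVEstimatesMultiDLinearStep.lean`):

* `IsStrictlyHyperbolicPencil.charpoly_eq_prod`: for `ξ ≠ 0` the characteristic polynomial of
  `K(ξ)` is `∏ᵢ (X - λᵢ)` with the `λᵢ` pairwise distinct (a monic polynomial of degree `k` with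
  `k` distinct roots);
* `IsStrictlyHyperbolicPencil.not_hasLinearEigenvalues`: if `d ≥ 2` and `k ≥ 2`, the
  eigenvalues of `K(ξ)` can NOT be chosen as real linear functions of `ξ`
  (`Literature.Analysis.Fourier.HasLinearEigenvalues`, the conclusion of
  [BrennerThomeeWahlbin1975, Ch. 5 Lemma 1.1]): two linear forms `ℓ₁, ℓ₂` on `ℝᵈ`, `d ≥ 2`,
  agree at some `ξ ≠ 0` (rank–nullity), where `K(ξ)` would have a double eigenvalue. This is
  the algebra behind "except for trivial cases, linear hyperbolic systems in dimension greater
  than one are not well posed in `Lᵖ` for `p ≠ 2`" [Rauch1986, p. 481]: by Brenner's theorem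
  well-posedness forces `P₁(D) = Σ Aⱼ∂ⱼ` with "diagonable, commuting matrices with real
  eigenvalues" [Brenner1973, Thm 0.1 p. 76, Thm 5.1 p. 93], whose eigenvalues are linear in
  `ξ`; the trivial cases are `d = 1` or `k = 1` [Rauch1986, Examples 1–2 p. 482].

## References

* [Rauch1986] J. Rauch, Comm. Math. Phys. 106 (1986) 481–484: p. 481, p. 482 (strict
  hyperbolicity), Examples 1–2.
* [Brenner1973] P. Brenner, Ark. Mat. 11 (1973) 75–101: Thm 0.1 p. 76, Thm 5.1 p. 93.
* [BrennerThomeeWahlbin1975] P. Brenner, V. Thomée, L. B. Wahlbin, LNM 434 (1975), Ch. 5 §1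
  Lemma 1.1 (linear eigenvalues).
-/

noncomputable section

open Polynomial Finset

namespace Literature.LinearAlgebra.Matrix

open Literature.Analysis.Fourier

variable {d k : ℕ}

/-- **Strictly hyperbolic real pencil**: for every `ξ ≠ 0`, `K(ξ) = Σⱼ ξⱼKⱼ` has `k` pairwise
distinct real eigenvalues `λᵢ`, each with a real eigenvector (the shape of the tree's
`QuasilinearSystem.IsStrictlyHyperbolicAt`, for the pencil `A₀⁻¹ Σ ξⱼAⱼ`).
[cite: Rauch1986, p. 482] -/
def IsStrictlyHyperbolicPencil (K : Fin d → Matrix (Fin k) (Fin k) ℝ) : Prop :=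
  ∀ ξ : Fin d → ℝ, ξ ≠ 0 → ∃ lam : Fin k → ℝ, Function.Injective lam ∧
    ∀ i, ∃ v : Fin k → ℝ, v ≠ 0 ∧ (∑ j, ξ j • K j).mulVec v = lam i • v

/-- An eigenvalue with an eigenvector is a root of the characteristic polynomial
(`det(λ - M) = 0`). [folklore] -/
theorem isRoot_charpoly_of_mulVec_eq {M : Matrix (Fin k) (Fin k) ℝ} {lam : ℝ} {v : Fin k → ℝ}
    (hv : v ≠ 0) (h : M.mulVec v = lam • v) : M.charpoly.IsRoot lam := by
  rw [IsRoot.def, Matrix.eval_charpoly, ← Matrix.exists_mulVec_eq_zero_iff]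
  refine ⟨v, hv, ?_⟩
  rw [Matrix.sub_mulVec, h]
  ext i
  simp [Matrix.scalar_apply]

/-- The roots of `∏ᵢ (X - aᵢ)` over `Fin k` are the multiset of the `aᵢ`. [folklore] -/
theorem roots_prod_X_sub_C_univ {R : Type*} [CommRing R] [IsDomain R] (a : Fin k → R) :
    (∏ i, (X - C (a i))).roots = univ.val.map a := by
  rw [Finset.prod_eq_multiset_prod,
    show (univ.val.map fun i => X - C (a i)) = (univ.val.map a).map fun x => X - C x by
      rw [Multiset.map_map]; rfl,
    roots_multiset_prod_X_sub_C]

/-- A monic polynomial of degree `k` with `k` distinct roots `λᵢ` is `∏ᵢ (X - λᵢ)`. [folklore] -/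
theorem eq_prod_X_sub_C_of_injective_of_isRoot {P : ℝ[X]} (hP : P.Monic)
    (hdeg : P.natDegree = k) {lam : Fin k → ℝ} (hinj : Function.Injective lam)
    (hroot : ∀ i, P.IsRoot (lam i)) : P = ∏ i, (X - C (lam i)) := by
  have hP0 : P ≠ 0 := hP.ne_zero
  have hnd : (univ.val.map lam : Multiset ℝ).Nodup :=
    (Multiset.nodup_map_iff_inj_on univ.nodup).2 fun x _ y _ h => hinj h
  -- the `k` distinct roots exhaust the root multiset
  have hle : (univ.val.map lam : Multiset ℝ) ≤ P.roots := by
    rw [Multiset.le_iff_subset hnd]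
    intro x hx
    obtain ⟨i, -, rfl⟩ := Multiset.mem_map.1 hx
    exact (mem_roots hP0).2 (hroot i)
  have hcardk : Multiset.card (univ.val.map lam : Multiset ℝ) = k := by simp
  have hcard : Multiset.card P.roots = P.natDegree := by
    refine le_antisymm (card_roots' P) ?_
    rw [hdeg, ← hcardk]
    exact Multiset.card_le_card hle
  have hroots : P.roots = univ.val.map lam :=
    (Multiset.eq_of_le_of_card_le hle (by rw [hcard, hdeg, hcardk])).symm
  rw [← prod_multiset_X_sub_C_of_monic_of_roots_card_eq hP hcard, hroots, Multiset.map_map,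
    Finset.prod_eq_multiset_prod]
  rfl

namespace IsStrictlyHyperbolicPencil

variable {K : Fin d → Matrix (Fin k) (Fin k) ℝ}

/-- **Simple real spectrum**: for a strictly hyperbolic pencil and `ξ ≠ 0`,
`charpoly K(ξ) = ∏ᵢ (X - λᵢ)` with `λ` injective. [cite: Rauch1986, p. 482] -/
theorem charpoly_eq_prod (hK : IsStrictlyHyperbolicPencil K) {ξ : Fin d → ℝ} (hξ : ξ ≠ 0) :
    ∃ lam : Fin k → ℝ, Function.Injective lam ∧
      (∑ j, ξ j • K j).charpoly = ∏ i, (X - C (lam i)) := by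
  obtain ⟨lam, hinj, hv⟩ := hK ξ hξ
  refine ⟨lam, hinj, eq_prod_X_sub_C_of_injective_of_isRoot (Matrix.charpoly_monic _)
    ((Matrix.charpoly_natDegree_eq_dim _).trans (Fintype.card_fin k)) hinj fun i => ?_⟩
  obtain ⟨v, hv0, hv⟩ := hv i
  exact isRoot_charpoly_of_mulVec_eq hv0 hv

/-- Complexification commutes with forming `K(ξ)`. [folklore] -/
theorem sum_smul_map_eq (K : Fin d → Matrix (Fin k) (Fin k) ℝ) (ξ : Fin d → ℝ) :
    ∑ j, ((ξ j : ℝ) : ℂ) • (K j).map (algebraMap ℝ ℂ) =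
      (∑ j, ξ j • K j).map (algebraMap ℝ ℂ) := by
  ext a b
  simp [Matrix.sum_apply, Matrix.map_apply, Matrix.smul_apply]

/-- **A strictly hyperbolic pencil in `d ≥ 2` variables of size `k ≥ 2` does not have linear
eigenvalues.** If `charpoly K(ξ) = ∏ₘ (X - ℓₘ(ξ))` with real linear forms `ℓₘ`, pick
`m₁ ≠ m₂`; the linear form `ℓ_{m₁} - ℓ_{m₂}` on `ℝᵈ`, `d ≥ 2`, has a nonzero kernel vector `ξ`
(rank–nullity), at which `K(ξ)` has the double root `ℓ_{m₁}(ξ) = ℓ_{m₂}(ξ)`, contradicting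
the simplicity of the spectrum at `ξ ≠ 0` (`charpoly_eq_prod`).
[cite: Brenner1973, Thm 0.1 p. 76; Rauch1986, pp. 481–482] -/
theorem not_hasLinearEigenvalues (hK : IsStrictlyHyperbolicPencil K) (hd : 2 ≤ d)
    (hk : 2 ≤ k) : ¬ HasLinearEigenvalues (fun j => (K j).map (algebraMap ℝ ℂ)) := by
  rintro ⟨c, hc⟩
  -- two distinct indices
  set m₁ : Fin k := ⟨0, by omega⟩ with hm₁
  set m₂ : Fin k := ⟨1, by omega⟩ with hm₂
  have hm : m₁ ≠ m₂ := by simp [hm₁, hm₂, Fin.ext_iff]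
  -- a nonzero `ξ` in the kernel of `ℓ_{m₁} - ℓ_{m₂}`
  let φ : (Fin d → ℝ) →ₗ[ℝ] ℝ :=
    { toFun := fun ξ => ∑ j, (c m₁ j - c m₂ j) * ξ j
      map_add' := fun x y => by
        simp only [Pi.add_apply, mul_add, Finset.sum_add_distrib]
      map_smul' := fun a x => by
        simp only [Pi.smul_apply, smul_eq_mul, RingHom.id_apply, Finset.mul_sum]
        exact Finset.sum_congr rfl fun j _ => by ring }
  have hker : LinearMap.ker φ ≠ ⊥ := by
    refine LinearMap.ker_ne_bot_of_finrank_lt ?_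
    simp only [Module.finrank_self, Module.finrank_fintype_fun_eq_card, Fintype.card_fin]
    omega
  obtain ⟨ξ, hξker, hξ0⟩ := Submodule.exists_mem_ne_zero_of_ne_bot hker
  have hφξ : ∑ j, c m₁ j * ξ j = ∑ j, c m₂ j * ξ j := by
    have h0 : ∑ j, (c m₁ j - c m₂ j) * ξ j = 0 := hξker
    rw [← sub_eq_zero, ← Finset.sum_sub_distrib]
    simpa only [sub_mul] using h0
  -- the spectrum at `ξ` is simple ...
  obtain ⟨lam, hinj, hchar⟩ := hK.charpoly_eq_prod hξ0
  have hcharC : (∑ j, ((ξ j : ℝ) : ℂ) • (K j).map (algebraMap ℝ ℂ)).charpoly =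
      ∏ i, (X - C ((lam i : ℝ) : ℂ)) := by
    rw [sum_smul_map_eq, Matrix.charpoly_map, hchar, Polynomial.map_prod]
    simp
  -- ... but the linear forms give a double root
  have hlin := hc ξ
  rw [hcharC] at hlin
  have hroots := congr_arg Polynomial.roots hlin
  rw [roots_prod_X_sub_C_univ, roots_prod_X_sub_C_univ] at hroots
  have hnd : (univ.val.map fun i => ((lam i : ℝ) : ℂ) : Multiset ℂ).Nodup :=
    (Multiset.nodup_map_iff_inj_on univ.nodup).2 fun x _ y _ h =>
      hinj (by exact_mod_cast h)
  rw [hroots, Multiset.nodup_map_iff_inj_on univ.nodup] at hnd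
  exact hm (hnd m₁ (by simp) m₂ (by simp) (by rw [hφξ]))

end IsStrictlyHyperbolicPencil

end Literature.LinearAlgebra.Matrix

end
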